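import Summits.AtomisticToContinuum.HydrodynamicLimit.Theorems.LambertianContactSwapLambertianEulerKineticInputs
import Summits.AtomisticToContinuum.HydrodynamicLimit.Theorems.LambertianContactSwapLambertianEulerKineticWindowTools
import Summits.AtomisticToContinuum.HydrodynamicLimit.Theorems.LambertianContactSwapLambertianEulerKineticArith
import Summits.AtomisticToContinuum.HydrodynamicLimit.Theorems.LambertianContactSwapLambertianEulerKlLedger
import HarnessLib

/-!
# The kinetic log-heart from its two research inputs: `KCW-Λ → TL1G-Λ → KineticOneBlockInMeanLambdaLog` (line `Sketch`, crux stmt-11854)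

Support file (`--supports stmt-AtomisticToContinuum-11854`).  `kineticOneBlockInMeanLambdaLog_of_inputs`: the clamped kinetic window
large deviations under local-Gibbs restart (KCW-Λ, `…KineticInputs.KineticClampedWindowLDLambda`) and the Gaussian velocity tails along `Λ`
(TL1G-Λ, `…KineticInputs.GaussianVelocityTailsLambda`) imply the kinetic LOG-heart P3Λ-log (`…HeartsLog.KineticOneBlockInMeanLambdaLog`).
This is lead c6's dissection (`Lines/Sketch.md` §c6.3) made a theorem, in the shell lead c7 showed it delivers (§c7.2): given `κ > 0`
and a small tolerance `ε`, clamp the current at `V(ε) := c₀ κ |log ε|` (`eps_threshold_gauss`, p139131), take the rate `γ := c₀/V` (so the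
entropy constant is `1/γ = κ|log ε|`), pay the clamp remainder with the Gaussian tails (`remainder_le_of_tails`: `≤ t·C_Y·A e^{−aV²}(N+1)
≤ (ε/3)(N+1)`), and on the clamped current use, interval by interval: for `s′ − s < h₀` the trivial bound of a bounded observable
(`abs_window_le`), otherwise `m = ⌊(s′−s)/h₀⌋` equal windows of length `h ∈ [h₀, 2h₀]` (`window_count`, `window_sum_eq`), each paid by
the entropy step with restart at rate `γ/h` (`neg_window_le_of_ent` = ENT p136234) — entropy `≤ (h/γ)·M`, log-moment-generating function
`≤ (h/γ)·γϑ(N+1)` by KCW-Λ with `ϑ = ε/(3t)` — summing to `κ|log ε|·(s′−s)·M + (ε/3)(N+1)`.  Frame plumbing (bands `min ηk ηv (r/2)`,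
reference profiles, ledger finiteness p120487, the time-clamped current of B2 p133972 and its cubic growth) as in `…OfHearts` /
`…ProductionSplit`.  Lead prover-line-stmt-AtomisticToContinuum-11854-c7-0, 2026-08-17.  [cite: Yau1991, §2] [cite: OllaVaradhanYau1993, §3]
-/

noncomputable section

namespace Summit.AtomisticToContinuum.HydrodynamicLimit.Theorems.LambertianContactSwapLambertianEulerKineticHeartOfInputs

open scoped BigOperators Topology ENNReal InnerProductSpace
open MeasureTheory ProbabilityTheory Filter Set InformationTheory
open Literature.MathematicalPhysics.KineticTheory
open Literature.Analysis.FluidPDE Literature.Analysis.FluidPDE.Alexander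
open Literature.Analysis.FunctionSpaces
open Summit.AtomisticToContinuum.HydrodynamicLimit.Theorems
open Summit.AtomisticToContinuum.HydrodynamicLimit.Theorems.LambertianContactSwapLambertianEulerHearts
open Summit.AtomisticToContinuum.HydrodynamicLimit.Theorems.LambertianContactSwapLambertianEulerHeartsLog
open Summit.AtomisticToContinuum.HydrodynamicLimit.Theorems.LambertianContactSwapLambertianEulerKineticInputs
open Summit.AtomisticToContinuum.HydrodynamicLimit.Theorems.LambertianContactSwapLambertianEulerKineticWindowTools
open Summit.AtomisticToContinuum.HydrodynamicLimit.Theorems.LambertianContactSwapLambertianEulerKineticArith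
open Summit.AtomisticToContinuum.HydrodynamicLimit.Theorems.LambertianContactSwapLambertianEulerProductionSplitTools

/-- **THE KINETIC LOG-HEART FROM ITS TWO RESEARCH INPUTS.** `KCW-Λ → TL1G-Λ → P3Λ-log`: clamp at `V(ε) = c₀κ|log ε|`, rate `γ = c₀/V`,
Gaussian-tail remainder, equal macroscopic windows paid by the entropy step with restart and the clamped window large deviations.
[cite: Yau1991, §2] [cite: OllaVaradhanYau1993, §3] -/
theorem kineticOneBlockInMeanLambdaLog_of_inputs : Summit.AtomisticToContinuum.HydrodynamicLimit.Theorems.LambertianContactSwapLambertianEulerKineticInputs.KineticClampedWindowLDLambda → Summit.AtomisticToContinuum.HydrodynamicLimit.Theorems.LambertianContactSwapLambertianEulerKineticInputs.GaussianVelocityTailsLambda → Summit.AtomisticToContinuum.HydrodynamicLimit.Theorems.LambertianContactSwapLambertianEulerHeartsLog.KineticOneBlockInMeanLambdaLog := by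
  intro hK hT r Rf hr hsol hbd hcont huniq
  obtain ⟨ηk, hηk, σk, hσk, HK⟩ := hK r Rf hr hsol hbd hcont huniq
  obtain ⟨ηv, hηv, HT⟩ := hT
  refine ⟨min ηk (min ηv (r / 2)), lt_min hηk (lt_min hηv (by positivity)), fun a₀ θ₀ u₀ ha hθ hu ha0 hθ0 => ?_⟩
  obtain ⟨σv, hσv, HT⟩ := HT a₀ θ₀ u₀ ha hθ hu ha0 hθ0
  refine ⟨min σk (min σv (1 / 2)), lt_min hσk (lt_min hσv (by norm_num)), ?_⟩
  intro σ hσ hσlt T ρ θ u hE hband Φ htie t ht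
  have hσk' : σ < σk := hσlt.trans_le (min_le_left _ _)
  have hσv' : σ < σv := hσlt.trans_le ((min_le_right _ _).trans (min_le_left _ _))
  have hσ2' : σ < 1 / 2 := hσlt.trans_le ((min_le_right _ _).trans (min_le_right _ _))
  have hσ2 : σ ≤ 1 / 2 := hσ2'.le
  have hσi : σ < 2⁻¹ := by rw [inv_eq_one_div]; exact hσ2'
  have hbandk : ∀ t' ∈ Set.Ico 0 T, ∀ x, ρ t' x * σ ^ 3 < ηk := fun t' ht' x =>
    (hband t' ht' x).trans_le (min_le_left _ _)
  have hbandv : ∀ t' ∈ Set.Ico 0 T, ∀ x, ρ t' x * σ ^ 3 < ηv := fun t' ht' x =>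
    (hband t' ht' x).trans_le ((min_le_right _ _).trans (min_le_left _ _))
  have hbandr : ∀ t' ∈ Set.Ico 0 T, ∀ x, ρ t' x * σ ^ 3 < r / 2 := fun t' ht' x =>
    (hband t' ht' x).trans_le ((min_le_right _ _).trans (min_le_right _ _))
  -- the two inputs at this horizon
  obtain ⟨c₀, hc₀, HK⟩ := HK σ hσ hσk' T ρ θ u hE hbandk Φ t ht
  obtain ⟨A, a, hA, ha_, HT⟩ := HT σ hσ hσv' T ρ θ u hE hbandv Φ htie t ht
  haveI hPlam : ∀ N, IsProbabilityMeasure (localGibbsLaw σ a₀ u₀ θ₀ N (Φ N)) := fun N =>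
    isProbabilityMeasure_localGibbsLaw ha hθ hu ha0 hθ0 hσ2 N (Φ N)
  /- ── reference profiles along `[0, t]`: continuity, positivity, probability, finiteness of the entropy ── -/
  have href : ∀ s ∈ Set.Icc 0 t, (Continuous fun x => ρ s x * Rf (σ ^ 3 * ρ s x)) ∧
      (∀ x, 0 < ρ s x * Rf (σ ^ 3 * ρ s x)) ∧ Continuous (θ s) ∧ Continuous (u s) ∧ ∀ x, 0 < θ s x := by
    intro s hs
    have hsI : s ∈ Set.Ico 0 T := ⟨hs.1, hs.2.trans_lt ht.2⟩
    have hρc : Continuous (ρ s) := (hE.smooth_density.isSmooth_slice hsI).continuous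
    have huc : Continuous (u s) := (hE.smooth_velocity.isSmooth_slice hsI).continuous
    have hθc : Continuous (θ s) := (hE.smooth_temperature.isSmooth_slice hsI).continuous
    have hρpos : ∀ x, 0 < ρ s x := hE.density_pos s hsI
    have hθpos : ∀ x, 0 < θ s x := hE.temperature_pos s hsI
    have hσ3 : 0 < σ ^ 3 := by positivity
    have hmem : ∀ x, σ ^ 3 * ρ s x ∈ Set.Icc 0 r := fun x => by
      have h := hbandr s hsI x
      exact ⟨(mul_pos hσ3 (hρpos x)).le, by nlinarith [h, hρpos x, hr]⟩
    have hbc : Continuous fun x => ρ s x * Rf (σ ^ 3 * ρ s x) :=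
      hρc.mul (hcont.comp_continuous (continuous_const.mul hρc) hmem)
    have hbpos : ∀ x, 0 < ρ s x * Rf (σ ^ 3 * ρ s x) := fun x =>
      mul_pos (hρpos x) (one_pos.trans_le (hbd _ (hmem x)).1)
    exact ⟨hbc, hbpos, hθc, huc, hθpos⟩
  have hfin : ∀ (N : ℕ) (s : ℝ), s ∈ Set.Icc 0 t →
      klDiv (((localGibbsLaw σ a₀ u₀ θ₀ N (Φ N)).prod (lambertNoise (Fin 3))).map
          (fun p => lambertFlow (Torus.geometry (Fin 3)) (hsDiameter σ N) p.2 p.1 s))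
        (localGibbsLaw σ (fun x => ρ s x * Rf (σ ^ 3 * ρ s x)) (u s) (θ s) N (Φ N)) ≠ ⊤ := by
    intro N s hs
    obtain ⟨hbc, hbpos, hθc, huc, hθpos⟩ := href s hs
    have hPL : localGibbsLaw σ a₀ u₀ θ₀ N (Φ N) ≪ liouville (Torus.geometry (Fin 3)) (N + 1) (hsDiameter σ N) := by
      rw [localGibbsLaw, particleLaw_eq]; exact withDensity_absolutelyContinuous _ _
    have hEn := QuenchedCellClock.integrable_sum_norm_sq_localGibbsLaw ha hθ hu (fun x => (ha0 x).le) hθ0 N (Φ N)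
    have hK0 : klDiv (localGibbsLaw σ a₀ u₀ θ₀ N (Φ N)) (localGibbsLaw σ a₀ u₀ θ₀ N (Φ N)) ≠ ⊤ := by
      rw [klDiv_self]; exact ENNReal.zero_ne_top
    exact (LambertianContactSwapLambertianEulerKlLedger.stub_klLedgerLambda hσ hσi ha hθ hu ha0 hθ0 hbc hθc huc hbpos hθpos
      N (Φ N) (localGibbsLaw σ a₀ u₀ θ₀ N (Φ N)) hPL hEn hK0 s hs.1).1
  /- ── the fast kinetic current clamped in time to `[0, t]`: continuity, measurability, cubic growth ── -/
  have hU : UniqueDiffOn ℝ (Set.Ico (0 : ℝ) T) := uniqueDiffOn_Ico 0 T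
  have h0t : (0 : ℝ) ≤ t := ht.1.le
  set c : ℝ → ℝ := fun r' => max 0 (min r' t) with hc_def
  have hcm : ∀ r', c r' ∈ Set.Icc 0 t := fun r' => ⟨le_max_left _ _, max_le h0t (min_le_right _ _)⟩
  have hcmT : ∀ r', c r' ∈ Set.Ico 0 T := fun r' => ⟨(hcm r').1, (hcm r').2.trans_lt ht.2⟩
  have hcr : ∀ r' ∈ Set.Icc 0 t, c r' = r' := fun r' hr' => by
    simp only [hc_def, min_eq_left hr'.2, max_eq_right hr'.1]
  have hΘc : Continuous fun p : ℝ × T3 => θ (c p.1) p.2 :=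
    continuous_clamp hE.smooth_temperature.continuousOn_stLift le_rfl h0t ht.2
  have hUc : Continuous fun p : ℝ × T3 => u (c p.1) p.2 :=
    continuous_clamp hE.smooth_velocity.continuousOn_stLift le_rfl h0t ht.2
  have hdΘ : ∀ k, Continuous fun p : ℝ × T3 => Torus.partialDeriv k (θ (c p.1)) p.2 := fun k =>
    continuous_clamp (hE.smooth_temperature.partialDeriv hU k).continuousOn_stLift le_rfl h0t ht.2
  have hdU : ∀ k j, Continuous fun p : ℝ × T3 => Torus.partialDeriv k (fun y => u (c p.1) y j) p.2 :=
    fun k j => continuous_clamp ((hE.smooth_velocity.apply j).partialDeriv hU k).continuousOn_stLift le_rfl h0t ht.2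
  have hΘ0 : ∀ p : ℝ × T3, θ (c p.1) p.2 ≠ 0 := fun p => (hE.temperature_pos _ (hcmT p.1) _).ne'
  set GY : ℝ × (T3 × V3) → ℝ := fun q => Ykin θ u (c q.1) q.2 with hGY
  have hGYm : Measurable GY :=
    (continuous_Y_aux (Θc := fun p => θ (c p.1) p.2) (Uc := fun p => u (c p.1) p.2)
      (dΘ := fun k p => Torus.partialDeriv k (θ (c p.1)) p.2)
      (dU := fun k j p => Torus.partialDeriv k (fun y => u (c p.1) y j) p.2) hΘc hUc hdΘ hdU hΘ0).measurable
  obtain ⟨CY, hCY0, hCY⟩ := exists_abs_Y_le (Θc := fun p => θ (c p.1) p.2) (Uc := fun p => u (c p.1) p.2)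
      (dΘ := fun k p => Torus.partialDeriv k (θ (c p.1)) p.2)
      (dU := fun k j p => Torus.partialDeriv k (fun y => u (c p.1) y j) p.2) hΘc hUc hdΘ hdU hΘ0 0 t
  have hcc : ∀ r', c (c r') = c r' := fun r' => hcr _ (hcm r')
  have hGYb : ∀ q : ℝ × (T3 × V3), |GY q| ≤ CY * (1 + ‖q.2.2‖) ^ 3 := by
    intro q
    have h := hCY (c q.1) (hcm q.1) q.2.1 q.2.2
    simp only [hcc] at h
    exact h
  have hGYeq : ∀ r' ∈ Set.Icc 0 t, ∀ y : T3 × V3, GY (r', y) = Ykin θ u r' y := fun r' hr' y => by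
    simp only [hGY, hcr r' hr']
  obtain ⟨W, hW0, hW⟩ := exists_forall_norm_le_window hUc 0 t
  have hWall : ∀ (r' : ℝ) (x : T3), ‖u (c r') x‖ ≤ W := fun r' x => by
    have h := hW (c r') (hcm r') x
    simp only [hcc] at h
    exact h
  /- ── the log-shell: clamp level, rate, tolerances ── -/
  intro κ hκ
  have htpos : 0 < t := ht.1
  obtain ⟨ε₀, hε₀, -, Hε⟩ := eps_threshold_gauss (P := t * CY * A) ha_ hc₀ hκ (by positivity)
  refine ⟨ε₀, hε₀, fun ε hε hεlt => ?_⟩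
  obtain ⟨hV1, hremε⟩ := Hε ε hε hεlt
  set V : ℝ := c₀ * κ * |Real.log ε| with hV_def
  have hVpos : 0 < V := one_pos.trans_le hV1
  have hV0 : 0 ≤ V := hVpos.le
  set γ : ℝ := c₀ / V with hγ_def
  have hγ : 0 < γ := div_pos hc₀ hVpos
  have hCγ : 1 / γ = κ * |Real.log ε| := by
    rw [hγ_def, one_div, inv_div, hV_def]; field_simp
  refine ⟨κ * |Real.log ε|, by positivity, le_rfl, ?_⟩
  -- KCW-Λ at the clamp level, the rate and `ϑ = ε/(3t)`
  have hϑ : 0 < ε / (3 * t) := by positivity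
  obtain ⟨w₀, hw₀, HKw⟩ := HK V hV1 γ hγ le_rfl (ε / (3 * t)) hϑ
  -- the clamped current: global bound, measurability
  set GYV : ℝ × (T3 × V3) → ℝ := fun q => YkinClamp V θ u (c q.1) q.2 with hGYV
  have hGYVb : ∀ q, |GYV q| ≤ CY * (1 + V + W) ^ 3 := fun q =>
    abs_YkinClamp_le hV0 hCY0 (hGYb q) (hWall q.1 q.2.1)
  have hGYVm : Measurable GYV := measurable_clampObs hGYm hUc V
  have hBV : 0 ≤ CY * (1 + V + W) ^ 3 := by positivity
  -- the minimal window `h₀`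
  set h₀ : ℝ := min w₀ (ε / (3 * (CY * (1 + V + W) ^ 3) + 3)) with hh₀_def
  have hh₀ : 0 < h₀ := lt_min hw₀ (by positivity)
  have hh₀w : h₀ ≤ w₀ := min_le_left _ _
  have hh₀B : h₀ * (CY * (1 + V + W) ^ 3) ≤ ε / 3 := by
    have h1 : h₀ ≤ ε / (3 * (CY * (1 + V + W) ^ 3) + 3) := min_le_right _ _
    have h2 : 0 < 3 * (CY * (1 + V + W) ^ 3) + 3 := by positivity
    rw [le_div_iff₀ h2] at h1
    nlinarith [hh₀.le]
  obtain ⟨N₁, HK1⟩ := HKw h₀ hh₀ hh₀w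
  obtain ⟨N₂, HT2⟩ := HT V hV1
  refine ⟨max N₁ N₂, fun N hN s s' M hs hss' hs't hM => ?_⟩
  have hN₁ : N₁ ≤ N := (le_max_left _ _).trans hN
  have hN₂ : N₂ ≤ N := (le_max_right _ _).trans hN
  have hn : (0 : ℝ) < (N : ℝ) + 1 := by positivity
  have hsI : s ∈ Set.Icc s s' := ⟨le_rfl, hss'⟩
  have hM0 : 0 ≤ M := ENNReal.toReal_nonneg.trans (hM s hsI)
  have hL0 : 0 ≤ s' - s := sub_nonneg.2 hss'
  have hIcc : Set.Icc s s' ⊆ Set.Icc 0 t := fun r' hr' => ⟨hs.trans hr'.1, hr'.2.trans hs't⟩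
  /- ── (1) the functional of the heart is the window functional of `GY` ── -/
  have hYint : Yint σ a₀ θ₀ u₀ θ u N (Φ N) s s' =
      ∫ p, (∫ r' in s..s', ∑ i, GY (r', lambertFlow (Torus.geometry (Fin 3)) (hsDiameter σ N) p.2 p.1 r' i))
        ∂((localGibbsLaw σ a₀ u₀ θ₀ N (Φ N)).prod (lambertNoise (Fin 3))) := by
    rw [Yint_eq]
    refine integral_congr_ae (Eventually.of_forall fun p => intervalIntegral.integral_congr fun r' hr' => ?_)
    rw [Set.uIcc_of_le hss'] at hr'
    exact Finset.sum_congr rfl fun i _ => (hGYeq r' (hIcc hr') _).symm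
  /- ── (2) clamp split and the Gaussian-tail remainder ── -/
  have hsplit := neg_window_le_clamp_add_remainder hσ hσi ha hθ hu ha0 hθ0 (Φ N) hGYm hss' hCY0
    (fun r' _ y => hGYb (r', y)) hUc V
  have hremD : ∀ r' ∈ Set.Icc s s',
      ∫ p, (∑ i, (if V < ‖(lambertFlow (Torus.geometry (Fin 3)) (hsDiameter σ N) p.2 p.1 r' i).2 -
          (fun p : ℝ × T3 => u (c p.1) p.2) (r', (lambertFlow (Torus.geometry (Fin 3)) (hsDiameter σ N) p.2 p.1 r' i).1)‖ then
          (1 + ‖(lambertFlow (Torus.geometry (Fin 3)) (hsDiameter σ N) p.2 p.1 r' i).2‖) ^ 3 else 0))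
        ∂((localGibbsLaw σ a₀ u₀ θ₀ N (Φ N)).prod (lambertNoise (Fin 3))) ≤ A * Real.exp (-(a * V ^ 2)) * ((N : ℝ) + 1) := by
    intro r' hr'
    have h := HT2 N hN₂ r' (hIcc hr')
    simp only [hcr r' (hIcc hr')]
    exact h
  have hrem := remainder_le_of_tails hσ hσi ha hθ hu ha0 hθ0 (Φ N) hGYm hss' hCY0 (fun r' _ y => hGYb (r', y)) hUc V hremD
  have hrem' : (s' - s) * (CY * (A * Real.exp (-(a * V ^ 2)) * ((N : ℝ) + 1))) ≤ ε / 3 * ((N : ℝ) + 1) := by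
    have e : (s' - s) * (CY * (A * Real.exp (-(a * V ^ 2)) * ((N : ℝ) + 1))) =
        ((s' - s) * (CY * A * Real.exp (-(a * V ^ 2)))) * ((N : ℝ) + 1) := by ring
    rw [e]
    refine mul_le_mul_of_nonneg_right ?_ hn.le
    have hX : 0 ≤ CY * A * Real.exp (-(a * V ^ 2)) := by positivity
    calc (s' - s) * (CY * A * Real.exp (-(a * V ^ 2))) ≤ t * (CY * A * Real.exp (-(a * V ^ 2))) :=
          mul_le_mul_of_nonneg_right (by linarith) hX
      _ = t * CY * A * Real.exp (-(a * (c₀ * κ * |Real.log ε|) ^ 2)) := by rw [hV_def]; ring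
      _ ≤ ε / 3 := hremε
  /- ── (3) the clamped current: trivial on short intervals, windows + entropy + KCW-Λ on long ones ── -/
  -- the clamped window functional in the two syntactic forms
  have hformV : ∀ (a' b' : ℝ),
      (∫ p, (∫ r' in a'..b', ∑ i, (if ‖(lambertFlow (Torus.geometry (Fin 3)) (hsDiameter σ N) p.2 p.1 r' i).2 -
          (fun p : ℝ × T3 => u (c p.1) p.2) (r', (lambertFlow (Torus.geometry (Fin 3)) (hsDiameter σ N) p.2 p.1 r' i).1)‖ ≤ V then
          GY (r', lambertFlow (Torus.geometry (Fin 3)) (hsDiameter σ N) p.2 p.1 r' i) else 0))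
        ∂((localGibbsLaw σ a₀ u₀ θ₀ N (Φ N)).prod (lambertNoise (Fin 3)))) =
      ∫ p, (∫ r' in a'..b', ∑ i, GYV (r', lambertFlow (Torus.geometry (Fin 3)) (hsDiameter σ N) p.2 p.1 r' i))
        ∂((localGibbsLaw σ a₀ u₀ θ₀ N (Φ N)).prod (lambertNoise (Fin 3))) := fun a' b' => rfl
  rw [hformV s s'] at hsplit
  have hclamp : -(∫ p, (∫ r' in s..s', ∑ i, GYV (r', lambertFlow (Torus.geometry (Fin 3)) (hsDiameter σ N) p.2 p.1 r' i))
        ∂((localGibbsLaw σ a₀ u₀ θ₀ N (Φ N)).prod (lambertNoise (Fin 3)))) ≤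
      κ * |Real.log ε| * (s' - s) * M + ε / 3 * ((N : ℝ) + 1) := by
    by_cases hLh : s' - s < h₀
    · -- short interval: bounded observable
      have hb := abs_window_le hσ2 ha hθ hu ha0 hθ0 (Φ N) hGYVb hss'
      have h1 : (s' - s) * (((N : ℝ) + 1) * (CY * (1 + V + W) ^ 3)) ≤ ε / 3 * ((N : ℝ) + 1) := by
        calc (s' - s) * (((N : ℝ) + 1) * (CY * (1 + V + W) ^ 3))
            ≤ h₀ * (((N : ℝ) + 1) * (CY * (1 + V + W) ^ 3)) := mul_le_mul_of_nonneg_right hLh.le (by positivity)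
          _ = (h₀ * (CY * (1 + V + W) ^ 3)) * ((N : ℝ) + 1) := by ring
          _ ≤ ε / 3 * ((N : ℝ) + 1) := mul_le_mul_of_nonneg_right hh₀B hn.le
      have h2 : 0 ≤ κ * |Real.log ε| * (s' - s) * M := by positivity
      linarith [neg_le_abs (∫ p, (∫ r' in s..s', ∑ i, GYV (r', lambertFlow (Torus.geometry (Fin 3)) (hsDiameter σ N) p.2 p.1 r' i))
        ∂((localGibbsLaw σ a₀ u₀ θ₀ N (Φ N)).prod (lambertNoise (Fin 3))))]
    · -- long interval: `m` equal windows of length `hw ∈ [h₀, 2h₀]`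
      push Not at hLh
      obtain ⟨m, hm1, hmlo, hmhi⟩ := window_count hh₀ hLh
      have hm0 : m ≠ 0 := Nat.one_le_iff_ne_zero.1 hm1
      have hmpos : (0 : ℝ) < m := by exact_mod_cast Nat.pos_of_ne_zero hm0
      set hw : ℝ := (s' - s) / m with hhw_def
      have hhw0 : 0 < hw := hh₀.trans_le hmlo
      have hmhw : (m : ℝ) * hw = s' - s := by rw [hhw_def]; field_simp
      rw [window_sum_eq hσ hσi ha hθ hu ha0 hθ0 (Φ N) hGYVm hGYVb hss' hm0]
      -- the `N`-particle clamped observable for the entropy step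
      set Gsum : ℝ × Config (N + 1) (Fin 3) T3 → ℝ := fun x => ∑ i, GYV (x.1, x.2 i) with hGsum
      have hGsm : Measurable Gsum :=
        Finset.measurable_sum _ fun i _ => hGYVm.comp (measurable_fst.prodMk ((measurable_pi_apply i).comp measurable_snd))
      have hGsb : ∀ x, |Gsum x| ≤ ((N : ℝ) + 1) * (CY * (1 + V + W) ^ 3) := by
        intro x
        calc |∑ i, GYV (x.1, x.2 i)| ≤ ∑ i, |GYV (x.1, x.2 i)| := Finset.abs_sum_le_sum_abs _ _
          _ ≤ ∑ _i : Fin (N + 1), CY * (1 + V + W) ^ 3 := Finset.sum_le_sum fun i _ => hGYVb _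
          _ = ((N : ℝ) + 1) * (CY * (1 + V + W) ^ 3) := by
              simp only [Finset.sum_const, Finset.card_univ, Fintype.card_fin, nsmul_eq_mul, Nat.cast_add, Nat.cast_one]
      have hPL : localGibbsLaw σ a₀ u₀ θ₀ N (Φ N) ≪ liouville (Torus.geometry (Fin 3)) (N + 1) (hsDiameter σ N) := by
        rw [localGibbsLaw, particleLaw_eq]; exact withDensity_absolutelyContinuous _ _
      -- per-window bound
      have hwin : ∀ k ∈ Finset.range m,
          -(∫ p, (∫ r' in (s + k * ((s' - s) / m))..(s + (k + 1) * ((s' - s) / m)),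
              ∑ i, GYV (r', lambertFlow (Torus.geometry (Fin 3)) (hsDiameter σ N) p.2 p.1 r' i))
            ∂((localGibbsLaw σ a₀ u₀ θ₀ N (Φ N)).prod (lambertNoise (Fin 3)))) ≤
          hw / γ * (M + γ * (ε / (3 * t)) * ((N : ℝ) + 1)) := by
        intro k hk
        have hklt : (k : ℝ) + 1 ≤ m := by exact_mod_cast Nat.succ_le_of_lt (Finset.mem_range.1 hk)
        have hk0 : (0 : ℝ) ≤ k := Nat.cast_nonneg k
        set aw : ℝ := s + k * hw with haw_def
        have haw0 : 0 ≤ aw := add_nonneg hs (mul_nonneg hk0 hhw0.le)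
        have haws : s ≤ aw := le_add_of_nonneg_right (mul_nonneg hk0 hhw0.le)
        have hawh : aw + hw ≤ s' := by
          have e1 : aw + hw = s + ((k : ℝ) + 1) * hw := by rw [haw_def]; ring
          have e2 : ((k : ℝ) + 1) * hw ≤ (m : ℝ) * hw := mul_le_mul_of_nonneg_right hklt hhw0.le
          rw [e1]
          linarith [e2, hmhw]
        have hawI : aw ∈ Set.Icc s s' := ⟨haws, by linarith⟩
        have hawt : aw + hw ≤ t := hawh.trans hs't
        have haw0t : aw ∈ Set.Icc 0 t := hIcc hawI
        -- the reference at time `aw` and the entropy bound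
        obtain ⟨hbc, hbpos, hθc, huc, hθpos⟩ := href aw haw0t
        haveI : IsProbabilityMeasure (localGibbsLaw σ (fun x => ρ aw x * Rf (σ ^ 3 * ρ aw x)) (u aw) (θ aw) N (Φ N)) :=
          isProbabilityMeasure_localGibbsLaw hbc hθc huc hbpos hθpos hσ2 N (Φ N)
        have hMa := hM aw hawI
        unfold Hent at hMa
        -- KCW-Λ on this window, rewritten on the time-clamped observable
        have hKa := HK1 N hN₁ aw hw haw0 hmlo hmhi hawt
        have hcong : ∀ q : Config (N + 1) (Fin 3) T3 × (ℕ → V3),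
            (∫ r' in (0 : ℝ)..hw, Gsum (aw + r', lambertFlow (Torus.geometry (Fin 3)) (hsDiameter σ N) q.2 q.1 r')) =
              ∫ r' in (0 : ℝ)..hw, ∑ i, YkinClamp V θ u (aw + r')
                (lambertFlow (Torus.geometry (Fin 3)) (hsDiameter σ N) q.2 q.1 r' i) := by
          intro q
          refine intervalIntegral.integral_congr fun r' hr' => ?_
          rw [Set.uIcc_of_le hhw0.le] at hr'
          have hmem : aw + r' ∈ Set.Icc 0 t := ⟨by linarith [hr'.1], by linarith [hr'.2]⟩
          simp only [hGsum, hGYV, hcr _ hmem]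
        have hΓ : Real.log (∫ q, Real.exp (-(γ / hw * ∫ r' in (0 : ℝ)..hw,
            Gsum (aw + r', lambertFlow (Torus.geometry (Fin 3)) (hsDiameter σ N) q.2 q.1 r')))
            ∂((localGibbsLaw σ (fun x => ρ aw x * Rf (σ ^ 3 * ρ aw x)) (u aw) (θ aw) N (Φ N)).prod (lambertNoise (Fin 3)))) ≤
            γ * (ε / (3 * t)) * ((N : ℝ) + 1) := by
          simp only [hcong]
          exact hKa
        have hent := neg_window_le_of_ent hσ hσi N (localGibbsLaw σ a₀ u₀ θ₀ N (Φ N))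
          (localGibbsLaw σ (fun x => ρ aw x * Rf (σ ^ 3 * ρ aw x)) (u aw) (θ aw) N (Φ N)) hPL Gsum hGsm _ hGsb
          haw0 hhw0 hγ (hfin N aw haw0t) hMa hΓ
        have hent' : -(∫ p, (∫ r' in aw..(aw + hw),
              ∑ i, GYV (r', lambertFlow (Torus.geometry (Fin 3)) (hsDiameter σ N) p.2 p.1 r' i))
            ∂((localGibbsLaw σ a₀ u₀ θ₀ N (Φ N)).prod (lambertNoise (Fin 3)))) ≤
            hw / γ * (M + γ * (ε / (3 * t)) * ((N : ℝ) + 1)) := by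
          simpa only [hGsum] using hent
        have e : s + ((k : ℝ) + 1) * ((s' - s) / m) = aw + hw := by rw [haw_def, hhw_def]; ring
        rw [e]
        exact hent'
      -- summing the windows
      rw [← Finset.sum_neg_distrib]
      have hsumle := Finset.sum_le_sum hwin
      have hconst : ∑ _k ∈ Finset.range m, hw / γ * (M + γ * (ε / (3 * t)) * ((N : ℝ) + 1)) =
          (m : ℝ) * (hw / γ * (M + γ * (ε / (3 * t)) * ((N : ℝ) + 1))) := by
        rw [Finset.sum_const, Finset.card_range, nsmul_eq_mul]
      have hγ0 : γ ≠ 0 := hγ.ne'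
      have ht0 : t ≠ 0 := htpos.ne'
      have halg : (m : ℝ) * (hw / γ * (M + γ * (ε / (3 * t)) * ((N : ℝ) + 1))) =
          κ * |Real.log ε| * (s' - s) * M + (s' - s) * (ε / (3 * t)) * ((N : ℝ) + 1) := by
        rw [← hmhw, ← hCγ]
        field_simp
      have h1 : (s' - s) * (ε / (3 * t)) ≤ ε / 3 :=
        calc (s' - s) * (ε / (3 * t)) ≤ t * (ε / (3 * t)) := mul_le_mul_of_nonneg_right (by linarith) hϑ.le
          _ = ε / 3 := by field_simp
      have h1n := mul_le_mul_of_nonneg_right h1 hn.le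
      linarith [hsumle, hconst, halg, h1n]
  /- ── (4) assembling ── -/
  rw [hYint]
  refine hsplit.trans ?_
  refine (add_le_add hclamp hrem).trans ?_
  have hεn : 0 ≤ ε * ((N : ℝ) + 1) := by positivity
  linarith [hrem', hεn]

end Summit.AtomisticToContinuum.HydrodynamicLimit.Theorems.LambertianContactSwapLambertianEulerKineticHeartOfInputs
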